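import Literature.Analysis.FunctionSpaces.SchwartzTranslationAverage
import Mathlib.Analysis.Distribution.SchwartzSpace.Deriv
import Mathlib.MeasureTheory.Measure.Haar.NormedSpace
import HarnessLib

/-!
# Scaled kernels `N_w(y) = w^{-m} N(y/w)` and their calculus

Topic `Literature/Analysis/Distribution`. Generic Schwartz-space tools for approximate identities
of the form `N_w(y) = w^{-m} N(y / w)` (`m = dim V`, `w > 0`) on a finite-dimensional real inner
product space `V`:

* `scaleKernel w N` — the scaled kernel as a Schwartz function, `scaleKernel_apply`,
  `scaleKernel_one`, `integral_scaleKernel` (`∫ N_w = ∫ N`), `integral_norm_scaleKernel`, and the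
  support `tsupport N ⊆ B̄(0, R) ⟹ tsupport N_w ⊆ B̄(0, wR)` (`tsupport_scaleKernel_subset`);
* `coordMul c N = ⟪·, c⟫ N` — multiplication by a linear coordinate (`SchwartzMap.smulLeftCLM`);
* **the scaling derivative has no negative power of `w`** (`hasDerivAt_scaleKernel`): for an
  orthonormal basis `(bⱼ)`,
  `∂_w N_w(y) = -∑ⱼ ∂_{bⱼ} ((⟪·, bⱼ⟫ N)_w)(y)`,
  i.e. the `w`-derivative of the scaled kernel is a *divergence* of scaled kernels of the same
  type (`div (X N)`), the algebraic fact behind the removal of a regularisation with polynomially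
  divergent bounds (`Literature/Analysis/Complex/AnalyticDeconvolution.lean`);
* interplay with the tree's averaging operators `K_{A,h} u = ∫ h(a) u(· − A a) da`
  (`Literature.Analysis.FunctionSpaces.SchwartzAverage.translationAverage`,
  `SchwartzTranslationAverage`): derivatives pass from the kernel to the function,
  `K_{id, ∂_v h} u = K_{id, h} (∂_v u)` (`translationAverage_lineDerivOp_kernel`); the coordinate
  Leibniz rule for convolutions `⟪·, c⟫ (h ∗ u) = (⟪·, c⟫ h) ∗ u + h ∗ (⟪·, c⟫ u)`
  (`coordMul_translationAverage`); scaling of convolutions `(h ∗ u)_w = h_w ∗ u_w`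
  (`scaleKernel_translationAverage`); supports and total mass of convolutions.

## References

* L. Hörmander, *The Analysis of Linear Partial Differential Operators I* (1983), §1.3
  (regularisation by convolution), Thm. 1.3.2.
* K. Osterwalder, R. Schrader, *Axioms for Euclidean Green's functions II*, Comm. Math. Phys. 42
  (1975) 281–305, Ch. VI.1 (regularised Schwinger functions `T_k = S_k ∗ k_ρ`, (6.3)–(6.5)).
  [OsterwalderSchraderCMP1975]

Everything here is elementary and tagged folklore.
-/

noncomputable section

open MeasureTheory Filter Set Module SchwartzMap
open scoped Topology RealInnerProductSpace LineDeriv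

namespace Literature.Analysis.Distribution

open Literature.Analysis.FunctionSpaces.SchwartzAverage

variable {V : Type*} [NormedAddCommGroup V] [InnerProductSpace ℝ V]

/-! ### The scaled kernel -/

/-- The dilation `y ↦ w⁻¹ y` as a continuous linear automorphism (`w ≠ 0`). [folklore] -/
def invDilation {w : ℝ} (hw : w ≠ 0) : V ≃L[ℝ] V :=
  ContinuousLinearEquiv.smulLeft ((Units.mk0 w hw)⁻¹ : ℝˣ)

/-- `invDilation hw y = w⁻¹ • y`. [folklore] -/
@[simp]
theorem invDilation_apply {w : ℝ} (hw : w ≠ 0) (y : V) : invDilation hw y = w⁻¹ • y := by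
  rw [invDilation, ContinuousLinearEquiv.smulLeft_apply_apply, Units.smul_def, Units.val_inv_eq_inv_val,
    Units.val_mk0]

/-- **The scaled kernel** `N_w(y) = w^{-m} N(w⁻¹ y)`, `m = dim V` (for `w = 0` the junk value `N`).
[folklore] -/
def scaleKernel (w : ℝ) (N : 𝓢(V, ℂ)) : 𝓢(V, ℂ) :=
  if hw : w = 0 then N else
    ((w ^ finrank ℝ V)⁻¹ : ℝ) • SchwartzMap.compCLMOfContinuousLinearEquiv ℂ (invDilation hw) N

/-- Pointwise formula for the scaled kernel. [folklore] -/
theorem scaleKernel_apply {w : ℝ} (hw : w ≠ 0) (N : 𝓢(V, ℂ)) (y : V) :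
    scaleKernel w N y = ((w ^ finrank ℝ V)⁻¹ : ℝ) • N (w⁻¹ • y) := by
  simp [scaleKernel, hw]

/-- Scaling by `1` does nothing. [folklore] -/
@[simp]
theorem scaleKernel_one (N : 𝓢(V, ℂ)) : scaleKernel 1 N = N := by
  ext y
  rw [scaleKernel_apply one_ne_zero]
  simp

section Integral

variable [FiniteDimensional ℝ V] [MeasurableSpace V] [BorelSpace V]

/-- **The total mass is scale invariant**: `∫ N_w = ∫ N` (`w > 0`). [folklore] -/
theorem integral_scaleKernel {w : ℝ} (hw : 0 < w) (N : 𝓢(V, ℂ)) :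
    ∫ y, scaleKernel w N y = ∫ y, N y := by
  simp_rw [scaleKernel_apply hw.ne']
  rw [integral_smul, Measure.integral_comp_inv_smul_of_nonneg volume N hw.le, ← smul_assoc,
    smul_eq_mul, inv_mul_cancel₀ (pow_ne_zero _ hw.ne'), one_smul]

/-- **The `L¹` norm is scale invariant**: `∫ ‖N_w‖ = ∫ ‖N‖` (`w > 0`). [folklore] -/
theorem integral_norm_scaleKernel {w : ℝ} (hw : 0 < w) (N : 𝓢(V, ℂ)) :
    ∫ y, ‖scaleKernel w N y‖ = ∫ y, ‖N y‖ := by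
  simp_rw [scaleKernel_apply hw.ne', norm_smul, Real.norm_eq_abs,
    abs_of_nonneg (inv_nonneg.2 (pow_nonneg hw.le _))]
  rw [integral_const_mul, Measure.integral_comp_inv_smul_of_nonneg volume (fun y => ‖N y‖) hw.le,
    smul_eq_mul, ← mul_assoc, inv_mul_cancel₀ (pow_ne_zero _ hw.ne'), one_mul]

end Integral

/-- **Support of the scaled kernel**: if `N` vanishes outside the closed ball `B̄(0, R)` then
`N_w` vanishes outside `B̄(0, wR)` (`w > 0`). [folklore] -/
theorem scaleKernel_eq_zero {w R : ℝ} (hw : 0 < w) {N : 𝓢(V, ℂ)}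
    (hN : ∀ y, R < ‖y‖ → N y = 0) {y : V} (hy : w * R < ‖y‖) : scaleKernel w N y = 0 := by
  rw [scaleKernel_apply hw.ne', hN _ ?_, smul_zero]
  rw [norm_smul, norm_inv, Real.norm_eq_abs, abs_of_pos hw]
  rwa [lt_inv_mul_iff₀ hw]

/-- A function whose topological support lies in `B̄(0, R)` vanishes outside it. [folklore] -/
theorem eq_zero_of_tsupport_subset_closedBall {R : ℝ} {N : 𝓢(V, ℂ)}
    (hN : tsupport (N : V → ℂ) ⊆ Metric.closedBall 0 R) (y : V) (hy : R < ‖y‖) : N y = 0 := by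
  refine image_eq_zero_of_notMem_tsupport fun h => ?_
  have := hN h
  rw [Metric.mem_closedBall, dist_zero_right] at this
  linarith

/-- **Topological support of the scaled kernel.** [folklore] -/
theorem tsupport_scaleKernel_subset {w R : ℝ} (hw : 0 < w) {N : 𝓢(V, ℂ)}
    (hN : tsupport (N : V → ℂ) ⊆ Metric.closedBall 0 R) :
    tsupport (scaleKernel w N : V → ℂ) ⊆ Metric.closedBall 0 (w * R) := by
  refine closure_minimal (fun y hy => ?_) Metric.isClosed_closedBall
  rw [Metric.mem_closedBall, dist_zero_right]
  by_contra h
  exact hy (scaleKernel_eq_zero hw (eq_zero_of_tsupport_subset_closedBall hN) (not_le.1 h))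

/-! ### Multiplication by a coordinate -/

/-- Multiplication by the linear coordinate `⟪·, c⟫`: `(X_c N)(y) = ⟪y, c⟫ N(y)`. [folklore] -/
def coordMul (c : V) (N : 𝓢(V, ℂ)) : 𝓢(V, ℂ) :=
  SchwartzMap.smulLeftCLM ℂ (fun y : V => ((⟪y, c⟫ : ℝ) : ℂ)) N

/-- The coordinate function has temperate growth. [folklore] -/
theorem hasTemperateGrowth_inner_ofReal (c : V) :
    (fun y : V => ((⟪y, c⟫ : ℝ) : ℂ)).HasTemperateGrowth :=
  (Function.RCLike.hasTemperateGrowth_ofReal ℂ).comp (Function.hasTemperateGrowth_inner_left c)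

/-- Pointwise formula for `coordMul`. [folklore] -/
@[simp]
theorem coordMul_apply (c : V) (N : 𝓢(V, ℂ)) (y : V) : coordMul c N y = ((⟪y, c⟫ : ℝ) : ℂ) * N y := by
  rw [coordMul, SchwartzMap.smulLeftCLM_apply_apply (hasTemperateGrowth_inner_ofReal c)]
  rfl

/-- `coordMul` preserves vanishing outside a ball. [folklore] -/
theorem coordMul_eq_zero {R : ℝ} (c : V) {N : 𝓢(V, ℂ)} (hN : ∀ y, R < ‖y‖ → N y = 0) (y : V)
    (hy : R < ‖y‖) : coordMul c N y = 0 := by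
  rw [coordMul_apply, hN y hy, mul_zero]

/-- `coordMul` does not enlarge the topological support. [folklore] -/
theorem tsupport_coordMul_subset (c : V) (N : 𝓢(V, ℂ)) :
    tsupport (coordMul c N : V → ℂ) ⊆ tsupport (N : V → ℂ) := by
  refine closure_mono fun y hy => ?_
  rw [Function.mem_support] at hy ⊢
  intro h
  exact hy (by rw [coordMul_apply, h, mul_zero])


/-! ### The scaling derivative is a divergence -/

section Deriv

/-- Derivative in the scale of the explicit formula `w ↦ w^{-m} N(w⁻¹ y)` (`w ≠ 0`). [folklore] -/
theorem hasDerivAt_scaleFormula (N : 𝓢(V, ℂ)) (y : V) {w : ℝ} (hw : w ≠ 0) :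
    HasDerivAt (fun w' : ℝ => ((w' ^ finrank ℝ V)⁻¹ : ℝ) • N (w'⁻¹ • y))
      (((w ^ finrank ℝ V)⁻¹ : ℝ) • fderiv ℝ N (w⁻¹ • y) (-(w ^ 2)⁻¹ • y) +
        (-((finrank ℝ V : ℝ) * w ^ (finrank ℝ V - 1)) / (w ^ finrank ℝ V) ^ 2) • N (w⁻¹ • y)) w := by
  have h1 : HasDerivAt (fun w' : ℝ => w'⁻¹ • y) (-(w ^ 2)⁻¹ • y) w := (hasDerivAt_inv hw).smul_const y
  have h2 : HasDerivAt (fun w' : ℝ => N (w'⁻¹ • y)) (fderiv ℝ N (w⁻¹ • y) (-(w ^ 2)⁻¹ • y)) w :=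
    (N.hasFDerivAt _).comp_hasDerivAt w h1
  have h3 : HasDerivAt (fun w' : ℝ => ((w' ^ finrank ℝ V)⁻¹ : ℝ))
      (-((finrank ℝ V : ℝ) * w ^ (finrank ℝ V - 1)) / (w ^ finrank ℝ V) ^ 2) w :=
    (hasDerivAt_pow _ w).inv (pow_ne_zero _ hw)
  exact h3.smul h2

/-- The gradient part of a coordinate multiple: `D(⟪·, c⟫ N)(z) v = ⟪z, c⟫ DN(z) v + ⟪v, c⟫ N(z)`.
[folklore] -/
theorem fderiv_coordMul_apply (c : V) (N : 𝓢(V, ℂ)) (z v : V) :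
    fderiv ℝ (coordMul c N) z v = ((⟪z, c⟫ : ℝ) : ℂ) * fderiv ℝ N z v + ((⟪v, c⟫ : ℝ) : ℂ) * N z := by
  have hfun : (⇑(coordMul c N) : V → ℂ) = fun z => ((⟪z, c⟫ : ℝ) : ℂ) * N z := funext (coordMul_apply c N)
  have hinner : HasFDerivAt (fun z : V => ((⟪z, c⟫ : ℝ) : ℂ))
      (Complex.ofRealCLM.comp (innerSL ℝ c)) z := by
    have h : (fun z : V => ((⟪z, c⟫ : ℝ) : ℂ)) = fun z => Complex.ofRealCLM (innerSL ℝ c z) := by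
      funext z; simp [real_inner_comm]
    rw [h]
    exact Complex.ofRealCLM.hasFDerivAt.comp z (innerSL ℝ c).hasFDerivAt
  have h : HasFDerivAt (fun z : V => ((⟪z, c⟫ : ℝ) : ℂ) * N z)
      (((⟪z, c⟫ : ℝ) : ℂ) • fderiv ℝ N z + N z • Complex.ofRealCLM.comp (innerSL ℝ c)) z :=
    hinner.mul (N.hasFDerivAt z)
  rw [hfun, h.fderiv]
  change ((⟪z, c⟫ : ℝ) : ℂ) * fderiv ℝ N z v + N z * (((innerSL ℝ c) v : ℝ) : ℂ) = _
  rw [innerSL_apply_apply, real_inner_comm v c]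
  ring

/-- The directional derivative of a scaled kernel:
`∂_v (M_w)(y) = w^{-m} w⁻¹ DM(w⁻¹ y) v`. [folklore] -/
theorem lineDerivOp_scaleKernel_apply (M : 𝓢(V, ℂ)) {w : ℝ} (hw : w ≠ 0) (y v : V) :
    (∂_{v} (scaleKernel w M)) y =
      ((w ^ finrank ℝ V)⁻¹ : ℝ) • (w⁻¹ : ℝ) • fderiv ℝ M (w⁻¹ • y) v := by
  rw [SchwartzMap.lineDerivOp_apply_eq_fderiv]
  have hfun : (⇑(scaleKernel w M) : V → ℂ) = fun y => ((w ^ finrank ℝ V)⁻¹ : ℝ) • M (w⁻¹ • y) :=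
    funext (scaleKernel_apply hw M)
  have hin : HasFDerivAt (fun y : V => w⁻¹ • y) (w⁻¹ • ContinuousLinearMap.id ℝ V) y :=
    (hasFDerivAt_id y).const_smul w⁻¹
  have hM : HasFDerivAt (fun y : V => M (w⁻¹ • y))
      ((fderiv ℝ M (w⁻¹ • y)).comp (w⁻¹ • ContinuousLinearMap.id ℝ V)) y :=
    (M.hasFDerivAt _).comp y hin
  have h : HasFDerivAt (fun y : V => ((w ^ finrank ℝ V)⁻¹ : ℝ) • M (w⁻¹ • y))
      (((w ^ finrank ℝ V)⁻¹ : ℝ) • (fderiv ℝ M (w⁻¹ • y)).comp (w⁻¹ • ContinuousLinearMap.id ℝ V)) y :=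
    hM.const_smul ((w ^ finrank ℝ V)⁻¹ : ℝ)
  rw [hfun, h.fderiv]
  simp

/-- **The divergence form of the scaling derivative, pointwise.** For an orthonormal basis
`(bⱼ)` of `V`, `∑ⱼ ∂_{bⱼ} ((⟪·, bⱼ⟫ N)_w)(y) = w^{-m} w⁻¹ (m N(z) + DN(z) z)`, `z = w⁻¹ y`
(`∑ⱼ ⟪z, bⱼ⟫ bⱼ = z`, `∑ⱼ ⟪bⱼ, bⱼ⟫ = m`). [folklore] -/
theorem sum_lineDerivOp_scaleKernel_coordMul {ι : Type*} [Fintype ι] (b : OrthonormalBasis ι ℝ V)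
    (N : 𝓢(V, ℂ)) {w : ℝ} (hw : w ≠ 0) (y : V) :
    ∑ j, (∂_{b j} (scaleKernel w (coordMul (b j) N))) y =
      ((w ^ finrank ℝ V)⁻¹ : ℝ) • (w⁻¹ : ℝ) •
        ((finrank ℝ V : ℂ) * N (w⁻¹ • y) + fderiv ℝ N (w⁻¹ • y) (w⁻¹ • y)) := by
  simp_rw [lineDerivOp_scaleKernel_apply _ hw, fderiv_coordMul_apply, ← Finset.smul_sum]
  congr 2
  rw [Finset.sum_add_distrib]
  have hrepr : ∑ j, ((⟪w⁻¹ • y, b j⟫ : ℝ) : ℂ) * fderiv ℝ N (w⁻¹ • y) (b j) =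
      fderiv ℝ N (w⁻¹ • y) (w⁻¹ • y) := by
    have h : ∀ j, ((⟪w⁻¹ • y, b j⟫ : ℝ) : ℂ) * fderiv ℝ N (w⁻¹ • y) (b j) =
        fderiv ℝ N (w⁻¹ • y) ((⟪b j, w⁻¹ • y⟫ : ℝ) • b j) := fun j => by
      rw [ContinuousLinearMap.map_smul, Complex.real_smul, real_inner_comm]
    simp_rw [h, ← map_sum, b.sum_repr']
  have hone : ∑ j, ((⟪b j, b j⟫ : ℝ) : ℂ) * N (w⁻¹ • y) = (finrank ℝ V : ℂ) * N (w⁻¹ • y) := by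
    have h : ∀ j, ((⟪b j, b j⟫ : ℝ) : ℂ) = 1 := fun j => by
      rw [real_inner_self_eq_norm_sq, b.orthonormal.1 j]; simp
    simp_rw [h, Finset.sum_const, Finset.card_univ, nsmul_eq_mul, one_mul,
      Module.finrank_eq_card_basis b.toBasis]
  rw [hrepr, hone, add_comm]

/-- **The scaling derivative is a divergence** (no negative power of the scale): for `w ≠ 0` and
an orthonormal basis `(bⱼ)` of `V`,
`∂_w N_w(y) = -∑ⱼ ∂_{bⱼ}((⟪·, bⱼ⟫ N)_w)(y)`.
(`∂_w [w^{-m} N(y/w)] = -w^{-m-1}[m N + z·∇N](y/w) = -w^{-m-1} (div (z N))(y/w)` and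
`(∂ⱼ M)_w = w ∂ⱼ(M_w)`.) [folklore] -/
theorem hasDerivAt_scaleKernel {ι : Type*} [Fintype ι] (b : OrthonormalBasis ι ℝ V) (N : 𝓢(V, ℂ))
    (y : V) {w : ℝ} (hw : w ≠ 0) :
    HasDerivAt (fun w' : ℝ => scaleKernel w' N y)
      (-∑ j, (∂_{b j} (scaleKernel w (coordMul (b j) N))) y) w := by
  have heq : (fun w' : ℝ => scaleKernel w' N y) =ᶠ[𝓝 w]
      fun w' : ℝ => ((w' ^ finrank ℝ V)⁻¹ : ℝ) • N (w'⁻¹ • y) := by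
    filter_upwards [isOpen_ne.mem_nhds hw] with w' hw'
    exact scaleKernel_apply hw' N y
  refine ((hasDerivAt_scaleFormula N y hw).congr_deriv ?_).congr_of_eventuallyEq heq
  rw [sum_lineDerivOp_scaleKernel_coordMul b N hw y]
  -- both sides are `w^{-m} w⁻¹`-multiples of `-(m N(z) + DN(z) z)`, `z = w⁻¹ y`
  set m : ℕ := finrank ℝ V with hm
  set z : V := w⁻¹ • y with hz
  have hfd : fderiv ℝ N z (-(w ^ 2)⁻¹ • y) = -(w⁻¹ : ℝ) • fderiv ℝ N z z := by
    rw [hz, ContinuousLinearMap.map_smul, ContinuousLinearMap.map_smul, smul_smul]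
    congr 1
    ring
  rw [hfd]
  -- rewrite all real scalar multiplications as complex multiplications
  simp only [Complex.real_smul, neg_smul, smul_add]
  -- the coefficient of `N z`: `-(m w^{m-1})/(w^m)^2 = -(w^m)⁻¹ w⁻¹ m`
  rcases Nat.eq_zero_or_pos m with hm0 | hmpos
  · simp [hm0]
  · have hcoef : (-((m : ℝ) * w ^ (m - 1)) / (w ^ m) ^ 2 : ℝ) = -((w ^ m)⁻¹ * w⁻¹ * m) := by
      have hw1 : w ^ m = w ^ (m - 1) * w := by
        rw [← pow_succ, Nat.sub_add_cancel hmpos]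
      rw [hw1]
      field_simp
    rw [hcoef]
    push_cast
    ring

end Deriv


/-! ### Interplay with the averaging operators `K_{id,h} u = ∫ h(a) u(· − a) da` -/

section Average

variable [FiniteDimensional ℝ V] [MeasurableSpace V] [BorelSpace V]

/-- Integrability of `a ↦ h(a) u(x − a)`. [folklore] -/
theorem integrable_mul_comp_sub (h u : 𝓢(V, ℂ)) (x : V) :
    Integrable (fun a : V => h a * u (x - a)) :=
  h.integrable.mul_bdd ((u.continuous.comp (continuous_const.sub continuous_id)).aestronglyMeasurable)
    (Eventually.of_forall fun a => u.norm_le_seminorm ℂ (x - a))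

/-- Pointwise formula for the averaging operator with `A = id`: `(K_{id,h} u)(x) = ∫ h(a) u(x − a) da`.
[folklore] -/
theorem translationAverage_id_apply (h u : 𝓢(V, ℂ)) (x : V) :
    translationAverage (ContinuousLinearMap.id ℝ V) h u x = ∫ a, h a * u (x - a) := by
  rw [translationAverage_apply]
  rfl

/-- **Derivatives pass from the kernel to the function**: `K_{id, ∂_v h} u = K_{id, h} (∂_v u)`
(both are the Fourier multiplier with symbol `2πi ⟪p, v⟫ 𝓕h(p)` applied to `u`; equivalently,
integration by parts in `∫ (∂_v h)(a) u(x − a) da`). [folklore] -/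
theorem translationAverage_id_lineDerivOp_kernel (h u : 𝓢(V, ℂ)) (v : V) :
    translationAverage (ContinuousLinearMap.id ℝ V) (∂_{v} h) u =
      translationAverage (ContinuousLinearMap.id ℝ V) h (∂_{v} u) := by
  rw [translationAverage_eq, translationAverage_eq, SchwartzMap.fourier_lineDerivOp_eq]
  congr 1
  ext p
  have hg : (inner ℝ · v : V → ℝ).HasTemperateGrowth := ((innerSL ℝ).flip v).hasTemperateGrowth
  rw [SchwartzMap.smulLeftCLM_apply_apply (averagingMultiplier_hasTemperateGrowth _ _),
    SchwartzMap.smulLeftCLM_apply_apply (averagingMultiplier_hasTemperateGrowth _ _),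
    averagingMultiplier_apply, averagingMultiplier_apply, ContinuousLinearMap.adjoint_id,
    ContinuousLinearMap.id_apply, ← SchwartzMap.fourier_coe, ← SchwartzMap.fourier_coe,
    SchwartzMap.fourier_lineDerivOp_eq, smul_apply, smul_apply,
    SchwartzMap.smulLeftCLM_apply_apply hg, SchwartzMap.smulLeftCLM_apply_apply hg]
  simp only [smul_eq_mul, Complex.real_smul]
  ring

/-- **Coordinate Leibniz rule for convolutions**:
`⟪·, c⟫ (K_{id,κ₁} κ₂) = K_{id, ⟪·,c⟫κ₁} κ₂ + K_{id,κ₁} (⟪·, c⟫ κ₂)`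
(`⟪x, c⟫ = ⟪a, c⟫ + ⟪x − a, c⟫` under the integral). [folklore] -/
theorem coordMul_translationAverage_id (c : V) (κ₁ κ₂ : 𝓢(V, ℂ)) :
    coordMul c (translationAverage (ContinuousLinearMap.id ℝ V) κ₁ κ₂) =
      translationAverage (ContinuousLinearMap.id ℝ V) (coordMul c κ₁) κ₂ +
        translationAverage (ContinuousLinearMap.id ℝ V) κ₁ (coordMul c κ₂) := by
  ext x
  rw [coordMul_apply, add_apply, translationAverage_id_apply, translationAverage_id_apply,
    translationAverage_id_apply, ← integral_const_mul,
    ← integral_add (integrable_mul_comp_sub _ _ x) (integrable_mul_comp_sub _ _ x)]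
  refine integral_congr_ae (Eventually.of_forall fun a => ?_)
  simp only [coordMul_apply, inner_sub_left, Complex.ofReal_sub]
  ring

/-- **Scaling of a convolution**: `(K_{id,κ₁} κ₂)_w = K_{id, (κ₁)_w} ((κ₂)_w)` (`w > 0`; the
substitution `a = w a'`). [folklore] -/
theorem scaleKernel_translationAverage_id {w : ℝ} (hw : 0 < w) (κ₁ κ₂ : 𝓢(V, ℂ)) :
    scaleKernel w (translationAverage (ContinuousLinearMap.id ℝ V) κ₁ κ₂) =
      translationAverage (ContinuousLinearMap.id ℝ V) (scaleKernel w κ₁) (scaleKernel w κ₂) := by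
  ext x
  rw [scaleKernel_apply hw.ne', translationAverage_id_apply, translationAverage_id_apply]
  simp_rw [scaleKernel_apply hw.ne', smul_sub]
  have hsub : ∀ a : V, ((w ^ finrank ℝ V)⁻¹ : ℝ) • κ₁ (w⁻¹ • a) *
      (((w ^ finrank ℝ V)⁻¹ : ℝ) • κ₂ (w⁻¹ • x - w⁻¹ • a)) =
      ((w ^ finrank ℝ V)⁻¹ : ℝ) • (((w ^ finrank ℝ V)⁻¹ : ℝ) •
        (fun a' : V => κ₁ a' * κ₂ (w⁻¹ • x - a')) (w⁻¹ • a)) := fun a => by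
    simp only [Complex.real_smul]
    ring
  simp_rw [hsub, integral_smul]
  rw [Measure.integral_comp_inv_smul_of_nonneg volume (fun a' : V => κ₁ a' * κ₂ (w⁻¹ • x - a')) hw.le,
    ← smul_assoc, ← smul_assoc, smul_eq_mul, smul_eq_mul, mul_assoc,
    inv_mul_cancel₀ (pow_ne_zero _ hw.ne'), mul_one]

/-- **Support of a convolution**: if `κ₁` vanishes outside `B̄(0, R₁)` and `κ₂` outside `B̄(0, R₂)`
then `K_{id,κ₁} κ₂` vanishes outside `B̄(0, R₁ + R₂)`. [folklore] -/
theorem translationAverage_id_eq_zero {R₁ R₂ : ℝ} {κ₁ κ₂ : 𝓢(V, ℂ)}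
    (h₁ : ∀ y, R₁ < ‖y‖ → κ₁ y = 0) (h₂ : ∀ y, R₂ < ‖y‖ → κ₂ y = 0) (x : V) (hx : R₁ + R₂ < ‖x‖) :
    translationAverage (ContinuousLinearMap.id ℝ V) κ₁ κ₂ x = 0 := by
  rw [translationAverage_id_apply]
  refine integral_eq_zero_of_ae (Eventually.of_forall fun a => ?_)
  by_cases ha : R₁ < ‖a‖
  · simp [h₁ a ha]
  · have hxa : R₂ < ‖x - a‖ := by
      have := norm_sub_norm_le x a
      push Not at ha
      linarith
    simp [h₂ _ hxa]

/-- **Topological support of a convolution.** [folklore] -/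
theorem tsupport_translationAverage_id_subset {R₁ R₂ : ℝ} {κ₁ κ₂ : 𝓢(V, ℂ)}
    (h₁ : tsupport (κ₁ : V → ℂ) ⊆ Metric.closedBall 0 R₁)
    (h₂ : tsupport (κ₂ : V → ℂ) ⊆ Metric.closedBall 0 R₂) :
    tsupport (translationAverage (ContinuousLinearMap.id ℝ V) κ₁ κ₂ : V → ℂ) ⊆
      Metric.closedBall 0 (R₁ + R₂) := by
  refine closure_minimal (fun y hy => ?_) Metric.isClosed_closedBall
  rw [Metric.mem_closedBall, dist_zero_right]
  by_contra h
  exact hy (translationAverage_id_eq_zero (eq_zero_of_tsupport_subset_closedBall h₁)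
    (eq_zero_of_tsupport_subset_closedBall h₂) y (not_le.1 h))

/-- **Total mass of a convolution**: `∫ K_{id,κ₁} κ₂ = (∫ κ₁)(∫ κ₂)` (Fubini). [folklore] -/
theorem integral_translationAverage_id (κ₁ κ₂ : 𝓢(V, ℂ)) :
    ∫ x, translationAverage (ContinuousLinearMap.id ℝ V) κ₁ κ₂ x = (∫ a, κ₁ a) * ∫ x, κ₂ x := by
  simp_rw [translationAverage_id_apply]
  have hint : Integrable (Function.uncurry fun (x a : V) => κ₁ a * κ₂ (x - a)) (volume.prod volume) := by
    simpa [Function.uncurry_def] using integrable_kernel (ContinuousLinearMap.id ℝ V) κ₁ κ₂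
  rw [integral_integral_swap hint]
  have h : ∀ a : V, ∫ x, κ₁ a * κ₂ (x - a) = κ₁ a * ∫ x, κ₂ x := fun a => by
    rw [integral_const_mul]
    congr 1
    exact integral_sub_right_eq_self (fun x => κ₂ x) a
  simp_rw [h, integral_mul_const]

/-- **`L¹` bound for a convolution**: `∫ ‖K_{id,κ₁} κ₂‖ ≤ (∫ ‖κ₁‖)(∫ ‖κ₂‖)`. [folklore] -/
theorem integral_norm_translationAverage_id_le (κ₁ κ₂ : 𝓢(V, ℂ)) :
    ∫ x, ‖translationAverage (ContinuousLinearMap.id ℝ V) κ₁ κ₂ x‖ ≤ (∫ a, ‖κ₁ a‖) * ∫ x, ‖κ₂ x‖ := by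
  simp_rw [translationAverage_id_apply]
  have hint' : Integrable (Function.uncurry fun (x a : V) => κ₁ a * κ₂ (x - a)) (volume.prod volume) := by
    simpa [Function.uncurry_def] using integrable_kernel (ContinuousLinearMap.id ℝ V) κ₁ κ₂
  calc ∫ x, ‖∫ a, κ₁ a * κ₂ (x - a)‖
      ≤ ∫ x, ∫ a, ‖κ₁ a * κ₂ (x - a)‖ :=
        integral_mono_of_nonneg (Eventually.of_forall fun _ => norm_nonneg _)
          hint'.norm.integral_prod_left (Eventually.of_forall fun x => norm_integral_le_integral_norm _)
    _ = ∫ a, ∫ x, ‖κ₁ a * κ₂ (x - a)‖ := integral_integral_swap hint'.norm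
    _ = (∫ a, ‖κ₁ a‖) * ∫ x, ‖κ₂ x‖ := by
        have h : ∀ a : V, ∫ x, ‖κ₁ a * κ₂ (x - a)‖ = ‖κ₁ a‖ * ∫ x, ‖κ₂ x‖ := fun a => by
          simp_rw [norm_mul]
          rw [integral_const_mul]
          congr 1
          exact integral_sub_right_eq_self (fun x => ‖κ₂ x‖) a
        simp_rw [h, integral_mul_const]

end Average

end Literature.Analysis.Distribution
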